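import Mathlib
import HarnessLib
import Summits.Ventures.LatticeQCDFlow.Exactness.SphereGradientFlowEulerStep

/-!
# Second-order consistency of the geodesic Euler step with the exact sphere gradient flow, uniformly on `Ω`: `‖Φ_ε(x)_n − eulerStep ε (−∂̃_nG(x)) (x_n)‖ ≤ C·ε²` for all `x ∈ Ω̃`, `|ε| ≤ 1`

HONEST FRAMING: exact (Metropolis-corrected) sampling algorithms for lattice gauge theory;
figures of merit are autocorrelation/cost numbers at stated couplings and volumes; no
continuum-physics claim.

Venture `LatticeQCDFlow` (cell pub-lqcd), topic `Exactness`; FANOUT row 7 (`s0-cpn-null`: the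
S0-D1 rung — Lüscher's LO trivializing flow for the lattice CP(N−1)/O(N) action integrated by
geodesic Euler steps inside HMC, Engel–Schaefer 2011).  NEW WORK of the cell over the tree's
`Exactness/SphereGradientFlowEulerStep.lean` (GEN-13: first-order consistency `o(ε)`),
`Exactness/SphereGradientFlow.lean` (GEN-13: the cut-off field `X` is `C¹` with compact support,
the global flow, `X = −∂̃G` on `Ω̃`), `Exactness/SphereLOFlowAction.lean` (E–S eq. (17):
`eulerStep_loGenerator`) and Mathlib (`Convex.norm_image_sub_le_of_norm_hasDerivWithin_le`,
`Real.one_sub_sq_div_two_le_cos`, `Real.abs_sub_sin_le`); nothing is cited as a fact.  Printed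
counterpart, NAMED ONLY: Engel–Schaefer, Comput. Phys. Commun. 182 (2011) 2107, §3 eqs. (14)–(17)
(the flow is integrated "using a simple Euler scheme"; one step is the exact free motion on the
sphere with the generator as momentum).

GEN-13's NOT-CLAIMED list had "the second-order local error `O(ε²)` (true, needs the `C²`
regularity of flow lines in time — not typed)".  THIS FILE types it, with a constant UNIFORM over
the product of unit spheres:

* §1 **THE STEP REMAINDER** (**`norm_eulerStep_sub_sub_le`**):
  `‖eulerStep ε T x − x − εT‖ ≤ (ε‖T‖)²/2·‖x‖ + |ε‖T‖|³/6` (`1 − cos θ ≤ θ²/2`, `|θ − sin θ| ≤ |θ|³/6`,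
  both from Mathlib, inlined).
* §2 **THE FLOW REMAINDER** (**`norm_sphereGradientFlow_sub_sub_le`**): flow lines of the cut-off
  field are `C²` in time with `ẍ = DX(x)·X(x)`, which is bounded on the whole ambient space
  (`X ∈ C¹` with compact support); two mean-value estimates give
  `‖Φ_ε(x) − x − ε·X(x)‖ ≤ B·ε²` FOR ALL `x` AND ALL `ε`, `B = sup‖DX·X‖`.
* §3 **UNIFORM SECOND-ORDER CONSISTENCY** (**`exists_norm_sphereGradientFlow_sub_eulerStep_le`**):
  there is `C` such that for every `x ∈ Ω̃`, every `|ε| ≤ 1` and every site `n`,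
  `‖Φ_ε(x)_n − eulerStep ε (−∂̃_nG(x)) (x_n)‖ ≤ C·ε²`; and for the E–S action
  (**`exists_norm_loFlow_sub_geodesicKick_le`**): `‖Φ_ε(x)_n − geodesicKick (εκ/(d−1)) (J_n x) (x_n)‖ ≤ C·ε²`
  — THE RUNG'S SITE MAP IS A SECOND-ORDER ACCURATE ONE-STEP INTEGRATOR OF THE EXACT LO TRIVIALIZING
  FLOW, UNIFORMLY ON THE CONFIGURATION SPACE.

NOT CLAIMED: the value of `C` in terms of the couplings (it comes from compactness); the global
error of many steps or of the sequential sweep (frozen neighbours); anything about the rung's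
numbers.
-/

noncomputable section

namespace Summit.Ventures.LatticeQCDFlow.Exactness

open Function Set Metric NormedSpace InnerProductSpace Filter
open scoped RealInnerProductSpace Topology

variable {E : Type*} [NormedAddCommGroup E] [InnerProductSpace ℝ E]

/-! ## §1 The step remainder -/

section Step

/-- **THE STEP REMAINDER**: `‖eulerStep ε T x − x − εT‖ ≤ (ε‖T‖)²/2·‖x‖ + |ε‖T‖|³/6`
(`|cos θ − 1| ≤ θ²/2` — the tree's `Literature/Geometry/DiscreteGeometry/ShellQuadCertTwelve` has it
as `abs_cos_sub_one_le`, re-derived inline here from Mathlib to keep the import graph topical — and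
Mathlib's `Real.abs_sub_sin_le`). -/
theorem norm_eulerStep_sub_sub_le (ε : ℝ) (T x : E) :
    ‖eulerStep ε T x - x - ε • T‖ ≤ (ε * ‖T‖) ^ 2 / 2 * ‖x‖ + |ε * ‖T‖| ^ 3 / 6 := by
  have hcos : ∀ θ : ℝ, |Real.cos θ - 1| ≤ θ ^ 2 / 2 := fun θ => by
    rw [abs_sub_comm, abs_of_nonneg (sub_nonneg.2 (Real.cos_le_one θ))]
    linarith [Real.one_sub_sq_div_two_le_cos (x := θ)]
  have hsin : ∀ θ : ℝ, |Real.sin θ - θ| ≤ |θ| ^ 3 / 6 := fun θ => by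
    rw [abs_sub_comm]
    exact Real.abs_sub_sin_le θ
  unfold eulerStep
  by_cases hT : T = 0
  · subst hT
    simp
  have hTn : ‖T‖ ≠ 0 := norm_ne_zero_iff.2 hT
  have e : Real.cos (ε * ‖T‖) • x + (Real.sin (ε * ‖T‖) / ‖T‖) • T - x - ε • T =
      (Real.cos (ε * ‖T‖) - 1) • x + ((Real.sin (ε * ‖T‖) - ε * ‖T‖) / ‖T‖) • T := by
    rw [sub_smul, one_smul, sub_div, mul_div_assoc, div_self hTn, mul_one, sub_smul]
    abel
  rw [e]
  calc ‖(Real.cos (ε * ‖T‖) - 1) • x + ((Real.sin (ε * ‖T‖) - ε * ‖T‖) / ‖T‖) • T‖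
      ≤ ‖(Real.cos (ε * ‖T‖) - 1) • x‖ + ‖((Real.sin (ε * ‖T‖) - ε * ‖T‖) / ‖T‖) • T‖ :=
        norm_add_le _ _
    _ = |Real.cos (ε * ‖T‖) - 1| * ‖x‖ + |Real.sin (ε * ‖T‖) - ε * ‖T‖| := by
        rw [norm_smul, norm_smul, Real.norm_eq_abs, Real.norm_eq_abs, abs_div, abs_norm,
          div_mul_cancel₀ _ hTn]
    _ ≤ (ε * ‖T‖) ^ 2 / 2 * ‖x‖ + |ε * ‖T‖| ^ 3 / 6 :=
        add_le_add (mul_le_mul_of_nonneg_right (hcos _) (norm_nonneg _)) (hsin _)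

/-- The step remainder for `|ε| ≤ 1` and `‖x‖ = 1`: `≤ ε²·(‖T‖²/2 + ‖T‖³/6)`. -/
theorem norm_eulerStep_sub_sub_le_of_abs_le_one {ε : ℝ} (hε : |ε| ≤ 1) (T : E) {x : E}
    (hx : ‖x‖ = 1) : ‖eulerStep ε T x - x - ε • T‖ ≤ ε ^ 2 * (‖T‖ ^ 2 / 2 + ‖T‖ ^ 3 / 6) := by
  refine (norm_eulerStep_sub_sub_le ε T x).trans ?_
  rw [hx, mul_one, abs_mul, abs_norm, mul_pow, mul_pow]
  have hT : 0 ≤ ‖T‖ := norm_nonneg T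
  have h3 : |ε| ^ 3 ≤ ε ^ 2 := by
    have h := pow_le_pow_left₀ (abs_nonneg ε) hε 1
    rw [one_pow, pow_one] at h
    calc |ε| ^ 3 = |ε| ^ 2 * |ε| := by ring
      _ ≤ |ε| ^ 2 * 1 := mul_le_mul_of_nonneg_left h (sq_nonneg _)
      _ = ε ^ 2 := by rw [mul_one, sq_abs]
  nlinarith [pow_nonneg hT 3, pow_nonneg hT 2, sq_nonneg ε]

end Step

/-! ## §2 The flow remainder -/

section Flow

variable {Λ : Type*} [Fintype Λ] [DecidableEq Λ] [FiniteDimensional ℝ E] {G : (Λ → E) → ℝ}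

/-- `y ↦ DX(y)·X(y)` (the acceleration field of the cut-off flow) is bounded on the ambient space:
`X` is `C¹` with compact support. -/
theorem exists_bound_fderiv_sphereFlowField_apply (hG : ContDiff ℝ 2 G) :
    ∃ B : ℝ, ∀ y : Λ → E, ‖fderiv ℝ (sphereFlowField G) y (sphereFlowField G y)‖ ≤ B := by
  have hX := contDiff_sphereFlowField hG
  have hc : Continuous fun y : Λ → E => fderiv ℝ (sphereFlowField G) y (sphereFlowField G y) :=
    (hX.continuous_fderiv one_ne_zero).clm_apply hX.continuous
  have hsupp : HasCompactSupport fun y : Λ → E =>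
      fderiv ℝ (sphereFlowField G) y (sphereFlowField G y) := by
    refine (hasCompactSupport_sphereFlowField (G := G)).mono ?_
    intro y hy
    rw [mem_support] at hy ⊢
    intro h0
    exact hy (by rw [h0, map_zero])
  exact hsupp.exists_bound_of_continuous hc

/-- **Flow lines are `C²` in time**: `(d/dt) X(Φ_t x) = DX(Φ_t x)·X(Φ_t x)`. -/
theorem hasDerivAt_sphereFlowField_comp_flow (hG : ContDiff ℝ 2 G) (x : Λ → E) (t : ℝ) :
    HasDerivAt (fun s => sphereFlowField G (sphereGradientFlow hG x s))
      (fderiv ℝ (sphereFlowField G) (sphereGradientFlow hG x t)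
        (sphereFlowField G (sphereGradientFlow hG x t))) t :=
  (((contDiff_sphereFlowField hG).differentiable one_ne_zero) _).hasFDerivAt.comp_hasDerivAt t
    (hasDerivAt_sphereGradientFlow_field hG x t)

/-- **THE FLOW REMAINDER**: if `‖DX(y)·X(y)‖ ≤ B` everywhere, then for every `x` and every real `ε`
`‖Φ_ε(x) − x − ε·X(x)‖ ≤ B·ε²` (two mean-value estimates). -/
theorem norm_sphereGradientFlow_sub_sub_le (hG : ContDiff ℝ 2 G) {B : ℝ}
    (hB : ∀ y : Λ → E, ‖fderiv ℝ (sphereFlowField G) y (sphereFlowField G y)‖ ≤ B) (x : Λ → E)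
    (ε : ℝ) :
    ‖sphereGradientFlow hG x ε - x - ε • sphereFlowField G x‖ ≤ B * ε ^ 2 := by
  -- first mean-value estimate: the velocity moves by at most `B|t|`
  have hvel : ∀ t : ℝ, ‖sphereFlowField G (sphereGradientFlow hG x t) - sphereFlowField G x‖ ≤
      B * |t| := fun t => by
    have h := Convex.norm_image_sub_le_of_norm_hasDerivWithin_le
      (f := fun s => sphereFlowField G (sphereGradientFlow hG x s)) (s := univ)
      (fun s _ => (hasDerivAt_sphereFlowField_comp_flow hG x s).hasDerivWithinAt)
      (fun s _ => hB _) convex_univ (mem_univ 0) (mem_univ t)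
    simpa only [sphereGradientFlow_zero, sub_zero, Real.norm_eq_abs] using h
  -- second: the position error `φ(t) = Φ_t x − x − tX(x)` has `φ' = X(Φ_t x) − X(x)`
  have hφ : ∀ t : ℝ, HasDerivAt (fun s => sphereGradientFlow hG x s - x - s • sphereFlowField G x)
      (sphereFlowField G (sphereGradientFlow hG x t) - sphereFlowField G x) t := fun t => by
    have h := ((hasDerivAt_sphereGradientFlow_field hG x t).sub_const x).fun_sub
      ((hasDerivAt_id' t).smul_const (sphereFlowField G x))
    simpa only [one_smul] using h
  have h := Convex.norm_image_sub_le_of_norm_hasDerivWithin_le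
    (f := fun s => sphereGradientFlow hG x s - x - s • sphereFlowField G x) (s := uIcc 0 ε)
    (C := B * |ε|) (fun t _ => (hφ t).hasDerivWithinAt) (fun t ht => ?_) (convex_uIcc 0 ε)
    left_mem_uIcc right_mem_uIcc
  · simp only [sphereGradientFlow_zero, sub_self, zero_smul, sub_zero, Real.norm_eq_abs] at h
    calc ‖sphereGradientFlow hG x ε - x - ε • sphereFlowField G x‖ ≤ B * |ε| * |ε| := h
      _ = B * ε ^ 2 := by rw [mul_assoc, ← sq, sq_abs]
  · refine (hvel t).trans (mul_le_mul_of_nonneg_left ?_ ?_)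
    · have := abs_sub_left_of_mem_uIcc ht
      simpa using this
    · have h0 := hB x
      exact (norm_nonneg _).trans h0

end Flow

/-! ## §3 Uniform second-order consistency on `Ω` -/

section Consistency

variable {Λ : Type*} [Fintype Λ] [DecidableEq Λ] [FiniteDimensional ℝ E] {G : (Λ → E) → ℝ}

/-- **UNIFORM SECOND-ORDER CONSISTENCY**: for `G ∈ C²` there is `C` such that for every `x ∈ Ω̃`,
every `|ε| ≤ 1` and every site `n`, `‖Φ_ε(x)_n − eulerStep ε (−∂̃_nG(x)) (x_n)‖ ≤ C·ε²`. -/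
theorem exists_norm_sphereGradientFlow_sub_eulerStep_le (hG : ContDiff ℝ 2 G) :
    ∃ C : ℝ, ∀ (x : Λ → E), (∀ n, ‖x n‖ = 1) → ∀ ε : ℝ, |ε| ≤ 1 → ∀ n,
      ‖sphereGradientFlow hG x ε n - eulerStep ε (-siteGrad n G x) (x n)‖ ≤ C * ε ^ 2 := by
  obtain ⟨B, hB⟩ := exists_bound_fderiv_sphereFlowField_apply hG
  obtain ⟨M, hM⟩ := exists_bound_sphereFlowField hG
  have hM0 : 0 ≤ M := (norm_nonneg _).trans (hM 0)
  refine ⟨B + (M ^ 2 / 2 + M ^ 3 / 6), fun x hx ε hε n => ?_⟩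
  have hX : sphereFlowField G x = fun m => -siteGrad m G x := sphereFlowField_eq_of_norm_eq_one hx
  -- the flow part, read at site `n`
  have h1 : ‖sphereGradientFlow hG x ε n - x n - ε • (-siteGrad n G x)‖ ≤ B * ε ^ 2 := by
    have h := norm_sphereGradientFlow_sub_sub_le hG hB x ε
    have hcomp : ‖(sphereGradientFlow hG x ε - x - ε • sphereFlowField G x) n‖ ≤
        ‖sphereGradientFlow hG x ε - x - ε • sphereFlowField G x‖ := norm_le_pi_norm _ n
    rw [hX] at hcomp h
    simpa only [Pi.sub_apply, Pi.smul_apply] using hcomp.trans h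
  -- the step part
  have hT : ‖-siteGrad n G x‖ ≤ M := by
    have h := norm_le_pi_norm (sphereFlowField G x) n
    rw [hX] at h
    exact h.trans (by rw [← hX]; exact hM x)
  have h2 : ‖eulerStep ε (-siteGrad n G x) (x n) - x n - ε • (-siteGrad n G x)‖ ≤
      ε ^ 2 * (M ^ 2 / 2 + M ^ 3 / 6) := by
    refine (norm_eulerStep_sub_sub_le_of_abs_le_one hε _ (hx n)).trans ?_
    have hT0 : 0 ≤ ‖-siteGrad n G x‖ := norm_nonneg _
    have hp2 : ‖-siteGrad n G x‖ ^ 2 ≤ M ^ 2 := pow_le_pow_left₀ hT0 hT 2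
    have hp3 : ‖-siteGrad n G x‖ ^ 3 ≤ M ^ 3 := pow_le_pow_left₀ hT0 hT 3
    exact mul_le_mul_of_nonneg_left (by linarith) (sq_nonneg ε)
  -- combine
  have e : sphereGradientFlow hG x ε n - eulerStep ε (-siteGrad n G x) (x n) =
      (sphereGradientFlow hG x ε n - x n - ε • (-siteGrad n G x)) -
        (eulerStep ε (-siteGrad n G x) (x n) - x n - ε • (-siteGrad n G x)) := by abel
  rw [e]
  calc ‖(sphereGradientFlow hG x ε n - x n - ε • (-siteGrad n G x)) -
        (eulerStep ε (-siteGrad n G x) (x n) - x n - ε • (-siteGrad n G x))‖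
      ≤ B * ε ^ 2 + ε ^ 2 * (M ^ 2 / 2 + M ^ 3 / 6) := (norm_sub_le _ _).trans (add_le_add h1 h2)
    _ = (B + (M ^ 2 / 2 + M ^ 3 / 6)) * ε ^ 2 := by ring

variable {U : Λ → Λ → (E →L[ℝ] E)}

/-- **THE RUNG'S SITE MAP IS SECOND-ORDER ACCURATE AGAINST THE EXACT LO TRIVIALIZING FLOW, UNIFORMLY
ON `Ω`**: for the E–S action (no self-coupling, adjoint pairs, `κ ≥ 0`, `d ≥ 2`) there is `C` with
`‖Φ_ε(x)_n − geodesicKick (εκ/(d−1)) (J_n x) (x_n)‖ ≤ C·ε²` for all `x ∈ Ω̃`, `|ε| ≤ 1`, all `n`,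
`Φ` the flow of `S̃⁽⁰⁾ = S/(2(d−1))`. -/
theorem exists_norm_loFlow_sub_geodesicKick_le (hU0 : ∀ n, U n n = 0)
    (hUadj : ∀ m n (v w : E), ⟪U m n v, w⟫ = ⟪v, U n m w⟫) (hd : 2 ≤ Module.finrank ℝ E)
    {κ : ℝ} (hκ : 0 ≤ κ) (S₀ : ℝ) :
    ∃ C : ℝ, ∀ (x : Λ → E), (∀ n, ‖x n‖ = 1) → ∀ ε : ℝ, |ε| ≤ 1 → ∀ n,
      ‖sphereGradientFlow (contDiff_loFlowAction U κ S₀) x ε n -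
          geodesicKick (ε * (κ / ((Module.finrank ℝ E : ℝ) - 1))) (localField U n x) (x n)‖ ≤
        C * ε ^ 2 := by
  obtain ⟨C, hC⟩ := exists_norm_sphereGradientFlow_sub_eulerStep_le
    (contDiff_loFlowAction U κ S₀ (m := 2))
  refine ⟨C, fun x hx ε hε n => ?_⟩
  have h := hC x hx ε hε n
  rwa [← loGenerator, eulerStep_loGenerator hU0 hUadj hd hκ S₀ ε (hx n)] at h

end Consistency

end Summit.Ventures.LatticeQCDFlow.Exactness

end
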